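import Literature.AlgebraicGeometry.GroupSchemes.StrictBirationalGroupLaw
import Mathlib.AlgebraicGeometry.Morphisms.Separated
import HarnessLib

/-!
# Associativity of a partial group law from the associativity of a sub-law on a dense open
# (Edixhoven–Romagny Def. 3.4 (3); Bosch–Lütkebohmert–Raynaud §5.1 Def. 1)

Topic `Literature/AlgebraicGeometry/GroupSchemes`, namespace `Literature.AlgebraicGeometry.GroupSchemes`.  THEOREMS ONLY.
Cell `hodgecm-mathlib`, road W (r₀), (W1) piece (G2b)/(G0b) generic leaf (β) «`AssocOfLe`»: let `S` be a scheme,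
`𝒳 → S` an `S`-scheme with `𝒳 → S` separated and `(𝒳 ×_S 𝒳) ×_S 𝒳` irreducible and reduced, `D₀ ≤ D ⊆ 𝒳 ×_S 𝒳`
opens and `m : D → 𝒳` an `S`-morphism (law data `(D, m)`, ★ `LawData`).  IF the restricted law `(D₀, m|D₀)` is
associative on `T`-valued points whenever the four `D₀`-products are defined, AND there is ONE configuration of
`D₀`-witnesses on a non-empty `T` (so the open of `(𝒳 ×_S 𝒳) ×_S 𝒳` where the four `D₀`-products are defined is
non-empty), THEN `(D, m)` is associative on `T`-valued points whenever the four `D`-products are defined.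
PROOF. (1) Let `W ⊆ (𝒳 ×_S 𝒳) ×_S 𝒳` be the open where the four `D`-products `ab`, `bc`, `(ab)c`, `a(bc)` are
defined; any `T`-point `(a, b, c)` with four `D`-witnesses factors through `W` (★ `LawAssocOfGenericFibre` §4
plumbing, verbatim).  (2) UNIVERSAL EQUALITY on `W`: the two composites `W ⇉ 𝒳` agree on the open `W₀ ⊆ W` where
the four `D₀`-products are defined (the `D₀`-hypothesis applied to the `W₀`-valued point), `W₀ ≠ ∅` by the witness
configuration, hence `W₀ ↪ W` is dominant (`W` is an open of an irreducible space), and two `S`-morphisms from a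
reduced scheme to the separated `S`-scheme `𝒳` that agree after a dominant morphism are equal (Mathlib
`ext_of_isDominant_of_isSeparated`).
HC_CM is proved only modulo the 7 printed citations until rung 0 closes; banked leaf, no floor change.

## References
* [EdixhovenRomagny2012] B. Edixhoven, M. Romagny, *Group schemes out of birational group laws, Néron models*
  (arXiv:1204.1799; Panor. Synthèses 47 (2015) 15–38), Def. 3.4 (3), proof of Thm. 3.18 (associativity is checked
  on a dense open and propagated by separatedness).
* [BLRNeronModels1990] S. Bosch, W. Lütkebohmert, M. Raynaud, *Néron Models* (1990), §5.1 Def. 1, §5.2.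
-/

noncomputable section

set_option backward.isDefEq.respectTransparency false

universe u

namespace Literature.AlgebraicGeometry.GroupSchemes

open CategoryTheory Limits _root_.AlgebraicGeometry MonoidalCategory CartesianMonoidalCategory
open scoped CategoryTheory.Obj

/-! ## §1. Plumbing: open sub-`S`-schemes, dominance of non-empty opens -/

section Plumbing

variable {S : Scheme.{u}}

/-- A morphism into `X` whose image lies in the open `O ⊆ X` factors through the open sub-`S`-scheme `O`.
[folklore] -/
private theorem exists_lift_openOver' {X T : Over S} (O : X.left.Opens) (g : T ⟶ X)
    (h : Set.range g.left.base ⊆ (O : Set X.left)) :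
    ∃ t : T ⟶ Over.mk (O.ι ≫ X.hom), t ≫ Over.homMk O.ι rfl = g := by
  have h' : Set.range g.left.base ⊆ Set.range O.ι.base := by rwa [Scheme.Opens.range_ι]
  refine ⟨Over.homMk (IsOpenImmersion.lift O.ι g.left h') ?_, ?_⟩
  · change IsOpenImmersion.lift O.ι g.left h' ≫ O.ι ≫ X.hom = T.hom
    rw [IsOpenImmersion.lift_fac_assoc, Over.w g]
  · ext : 1
    exact IsOpenImmersion.lift_fac _ _ _

/-- The inclusion of an open sub-`S`-scheme is a monomorphism of `S`-schemes. [folklore] -/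
private theorem cancel_openOver' {X T : Over S} (O : X.left.Opens) {x y : T ⟶ Over.mk (O.ι ≫ X.hom)}
    (h : x ≫ Over.homMk O.ι rfl = y ≫ Over.homMk O.ι rfl) : x = y := by
  ext : 1
  rw [← cancel_mono O.ι]
  exact congrArg CommaMorphism.left h

/-- The image of `x ≫ (O ↪ X)` lies in `O`. [folklore] -/
private theorem range_comp_openOver_subset' {X T : Over S} (O : X.left.Opens)
    (x : T ⟶ Over.mk (O.ι ≫ X.hom)) :
    Set.range (x ≫ Over.homMk O.ι rfl).left.base ⊆ (O : Set X.left) := by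
  change Set.range (x.left ≫ O.ι).base ⊆ _
  rw [Scheme.Hom.comp_base, TopCat.coe_comp, Set.range_comp, ← Scheme.Opens.range_ι O]
  exact Set.image_subset_range _ _

/-- A scheme morphism into `X` whose image lies in the open `O ⊆ X` factors through `O`. [folklore] -/
private theorem exists_lift_open' {X T : Scheme.{u}} (O : X.Opens) (g : T ⟶ X)
    (h : Set.range g.base ⊆ (O : Set X)) : ∃ t : T ⟶ (O : Scheme.{u}), t ≫ O.ι = g := by
  have h' : Set.range g.base ⊆ Set.range O.ι.base := by rwa [Scheme.Opens.range_ι]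
  exact ⟨IsOpenImmersion.lift O.ι g h', IsOpenImmersion.lift_fac _ _ _⟩

/-- A non-empty open of a scheme admitting an open immersion into an irreducible scheme is dominant. [folklore] -/
private theorem isDominant_ι_of_nonempty {X Y : Scheme.{u}} [IrreducibleSpace Y] (f : X ⟶ Y) [IsOpenImmersion f]
    (O : X.Opens) [Nonempty (O : Scheme.{u})] : IsDominant O.ι := by
  haveI : PreirreducibleSpace X := f.isOpenEmbedding.preirreducibleSpace
  exact ⟨IsOpenMap.denseRange_of_isPreirreducibleSpace _ O.ι.isOpenEmbedding.isOpenMap⟩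

/-- `D₀`-witnesses are `D`-witnesses for `D₀ ≤ D`. [folklore] -/
private theorem computes_of_le {𝒳 : Over S} {D₀ D : (𝒳 ⊗ 𝒳).left.Opens} (hle : D₀ ≤ D)
    {m : (D : Scheme.{u}) ⟶ 𝒳.left} {T : Scheme.{u}} {q : T ⟶ (D₀ : Scheme.{u})} {a b c : T ⟶ 𝒳.left}
    (h : LawData.Computes 𝒳 D₀ ((𝒳 ⊗ 𝒳).left.homOfLE hle ≫ m) q a b c) :
    LawData.Computes 𝒳 D m (q ≫ (𝒳 ⊗ 𝒳).left.homOfLE hle) a b c := by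
  obtain ⟨ha, hb, hc⟩ := h
  exact ⟨by rw [Category.assoc, Scheme.homOfLE_ι_assoc, ha], by rw [Category.assoc, Scheme.homOfLE_ι_assoc, hb],
    by rw [Category.assoc, hc]⟩

end Plumbing

/-! ## §2. The head: associativity of `(D, m)` from associativity of `(D₀, m|D₀)` -/

/-- **Associativity of a partial law from the associativity of a sub-law** ([EdixhovenRomagny2012] Def. 3.4 (3),
and the density-plus-separatedness step in the proof of Thm. 3.18): for law data `(D, m)` on an `S`-scheme `𝒳` with
`𝒳 → S` separated and `(𝒳 ×_S 𝒳) ×_S 𝒳` irreducible and reduced, and an open `D₀ ≤ D`, IF the restricted law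
`(D₀, m|D₀)` satisfies `(ab)c = a(bc)` on `T`-valued points whenever the four `D₀`-products are witnessed, AND some
non-empty `T` carries one such configuration of `D₀`-witnesses, THEN `(D, m)` satisfies `(ab)c = a(bc)` on `T`-valued
points whenever the four `D`-products are witnessed.  (The `T`-point `(a, b, c)` factors through the open
`W ⊆ (𝒳 ×_S 𝒳) ×_S 𝒳` where the four `D`-products are defined; there the two triple products agree on the non-empty —
hence dominant — open where the four `D₀`-products are defined, so they agree by separatedness of `𝒳 → S`.)
[cite: EdixhovenRomagny2012, Def. 3.4 (3) and proof of Thm. 3.18] [cite: BLRNeronModels1990, §5.1 Def. 1] -/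
theorem LawData.assoc_of_le {S : Scheme.{u}} {𝒳 : Over S} [IsSeparated 𝒳.hom]
    [IrreducibleSpace ↑((𝒳 ⊗ 𝒳) ⊗ 𝒳).left] [IsReduced ((𝒳 ⊗ 𝒳) ⊗ 𝒳).left]
    (D₀ D : (𝒳 ⊗ 𝒳).left.Opens) (hle : D₀ ≤ D) (m : (D : Scheme.{u}) ⟶ 𝒳.left)
    (hm : m ≫ 𝒳.hom = D.ι ≫ (𝒳 ⊗ 𝒳).hom)
    (hassoc₀ : ∀ {T : Scheme.{u}} {a b c ab bc abc abc' : T ⟶ 𝒳.left} {q₁ q₂ q₃ q₄ : T ⟶ (D₀ : Scheme.{u})},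
      LawData.Computes 𝒳 D₀ ((𝒳 ⊗ 𝒳).left.homOfLE hle ≫ m) q₁ a b ab →
      LawData.Computes 𝒳 D₀ ((𝒳 ⊗ 𝒳).left.homOfLE hle ≫ m) q₂ b c bc →
      LawData.Computes 𝒳 D₀ ((𝒳 ⊗ 𝒳).left.homOfLE hle ≫ m) q₃ ab c abc →
      LawData.Computes 𝒳 D₀ ((𝒳 ⊗ 𝒳).left.homOfLE hle ≫ m) q₄ a bc abc' → abc = abc')
    (hne : ∃ (T : Scheme.{u}) (_ : Nonempty T) (a b c ab bc abc abc' : T ⟶ 𝒳.left)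
        (q₁ q₂ q₃ q₄ : T ⟶ (D₀ : Scheme.{u})),
      LawData.Computes 𝒳 D₀ ((𝒳 ⊗ 𝒳).left.homOfLE hle ≫ m) q₁ a b ab ∧
      LawData.Computes 𝒳 D₀ ((𝒳 ⊗ 𝒳).left.homOfLE hle ≫ m) q₂ b c bc ∧
      LawData.Computes 𝒳 D₀ ((𝒳 ⊗ 𝒳).left.homOfLE hle ≫ m) q₃ ab c abc ∧
      LawData.Computes 𝒳 D₀ ((𝒳 ⊗ 𝒳).left.homOfLE hle ≫ m) q₄ a bc abc')
    {T : Scheme.{u}} {a b c ab bc abc abc' : T ⟶ 𝒳.left} {q₁ q₂ q₃ q₄ : T ⟶ (D : Scheme.{u})}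
    (h₁ : LawData.Computes 𝒳 D m q₁ a b ab) (h₂ : LawData.Computes 𝒳 D m q₂ b c bc)
    (h₃ : LawData.Computes 𝒳 D m q₃ ab c abc) (h₄ : LawData.Computes 𝒳 D m q₄ a bc abc') :
    abc = abc' := by
  -- notation for the incl / mul of `D` as `S`-morphisms
  let incl : Over.mk (D.ι ≫ (𝒳 ⊗ 𝒳).hom) ⟶ 𝒳 ⊗ 𝒳 := Over.homMk D.ι rfl
  let mulR : Over.mk (D.ι ≫ (𝒳 ⊗ 𝒳).hom) ⟶ 𝒳 := Over.homMk m hm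
  -- the universal scheme: `O₁ ⊆ (𝒳 ⊗ 𝒳) ⊗ 𝒳` where `ab` and `bc` are defined …
  let Y3 : Over S := (𝒳 ⊗ 𝒳) ⊗ 𝒳
  let p12 : Y3 ⟶ 𝒳 ⊗ 𝒳 := fst _ _
  let p23 : Y3 ⟶ 𝒳 ⊗ 𝒳 := lift (fst _ _ ≫ snd 𝒳 𝒳) (snd _ _)
  let O₁ : Y3.left.Opens := p12.left ⁻¹ᵁ D ⊓ p23.left ⁻¹ᵁ D
  let W₁ : Over S := Over.mk (O₁.ι ≫ Y3.hom)
  let j₁ : W₁ ⟶ Y3 := Over.homMk O₁.ι rfl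
  have hr12 : Set.range (j₁ ≫ p12).left.base ⊆ (D : Set (𝒳 ⊗ 𝒳).left) := by
    rintro _ ⟨x, rfl⟩
    exact (x.2 : O₁.ι.base x ∈ O₁).1
  have hr23 : Set.range (j₁ ≫ p23).left.base ⊆ (D : Set (𝒳 ⊗ 𝒳).left) := by
    rintro _ ⟨x, rfl⟩
    exact (x.2 : O₁.ι.base x ∈ O₁).2
  obtain ⟨qab₁, hqab₁⟩ := exists_lift_openOver' D (j₁ ≫ p12) hr12
  obtain ⟨qbc₁, hqbc₁⟩ := exists_lift_openOver' D (j₁ ≫ p23) hr23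
  -- … and `O ⊆ O₁` where moreover `(ab)c` and `a(bc)` are defined
  let r₃ : W₁ ⟶ 𝒳 ⊗ 𝒳 := lift (qab₁ ≫ mulR) (j₁ ≫ snd _ _)
  let r₄ : W₁ ⟶ 𝒳 ⊗ 𝒳 := lift (j₁ ≫ fst _ _ ≫ fst 𝒳 𝒳) (qbc₁ ≫ mulR)
  let O : W₁.left.Opens := r₃.left ⁻¹ᵁ D ⊓ r₄.left ⁻¹ᵁ D
  let W : Over S := Over.mk (O.ι ≫ W₁.hom)
  let j : W ⟶ W₁ := Over.homMk O.ι rfl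
  have hr₃ : Set.range (j ≫ r₃).left.base ⊆ (D : Set (𝒳 ⊗ 𝒳).left) := by
    rintro _ ⟨x, rfl⟩
    exact (x.2 : O.ι.base x ∈ O).1
  have hr₄ : Set.range (j ≫ r₄).left.base ⊆ (D : Set (𝒳 ⊗ 𝒳).left) := by
    rintro _ ⟨x, rfl⟩
    exact (x.2 : O.ι.base x ∈ O).2
  obtain ⟨qab_c, hqab_c⟩ := exists_lift_openOver' D (j ≫ r₃) hr₃
  obtain ⟨qa_bc, hqa_bc⟩ := exists_lift_openOver' D (j ≫ r₄) hr₄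
  -- (1) FACTORISATION: a `T`-point with four `D`-witnesses factors through `W`, compatibly with the witnesses
  have factor : ∀ {T : Scheme.{u}} {a b c ab bc abc abc' : T ⟶ 𝒳.left} {q₁ q₂ q₃ q₄ : T ⟶ (D : Scheme.{u})},
      LawData.Computes 𝒳 D m q₁ a b ab → LawData.Computes 𝒳 D m q₂ b c bc →
      LawData.Computes 𝒳 D m q₃ ab c abc → LawData.Computes 𝒳 D m q₄ a bc abc' →
      ∃ t : T ⟶ W.left, t ≫ (qab_c ≫ mulR).left = abc ∧ t ≫ (qa_bc ≫ mulR).left = abc' ∧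
        t ≫ (j ≫ j₁ ≫ p12).left = q₁ ≫ D.ι ∧ t ≫ (j ≫ j₁ ≫ p23).left = q₂ ≫ D.ι ∧
        t ≫ (j ≫ r₃).left = q₃ ≫ D.ι ∧ t ≫ (j ≫ r₄).left = q₄ ≫ D.ι := by
    intro T a b c ab bc abc abc' q₁ q₂ q₃ q₄ h₁ h₂ h₃ h₄
    obtain ⟨h₁a, h₁b, h₁m⟩ := h₁
    obtain ⟨h₂a, h₂b, h₂m⟩ := h₂
    obtain ⟨h₃a, h₃b, h₃m⟩ := h₃
    obtain ⟨h₄a, h₄b, h₄m⟩ := h₄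
    -- `T` as an `S`-scheme through `a`; all the data are `S`-morphisms
    let TR : Over S := Over.mk (a ≫ 𝒳.hom)
    have hq₁ : (q₁ ≫ D.ι ≫ (𝒳 ⊗ 𝒳).hom) = a ≫ 𝒳.hom := by
      rw [← h₁a]; simp only [Category.assoc, Over.w (fst 𝒳 𝒳)]
    have hb : b ≫ 𝒳.hom = a ≫ 𝒳.hom := by
      rw [← h₁b, ← h₁a]; simp only [Category.assoc, Over.w (snd 𝒳 𝒳), Over.w (fst 𝒳 𝒳)]
    have hq₂ : (q₂ ≫ D.ι ≫ (𝒳 ⊗ 𝒳).hom) = a ≫ 𝒳.hom := by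
      rw [← hb, ← h₂a]; simp only [Category.assoc, Over.w (fst 𝒳 𝒳)]
    have hc : c ≫ 𝒳.hom = a ≫ 𝒳.hom := by
      rw [← hb, ← h₂b, ← h₂a]; simp only [Category.assoc, Over.w (snd 𝒳 𝒳), Over.w (fst 𝒳 𝒳)]
    have hab : ab ≫ 𝒳.hom = a ≫ 𝒳.hom := by rw [← h₁m, Category.assoc, hm, hq₁]
    have hq₃ : (q₃ ≫ D.ι ≫ (𝒳 ⊗ 𝒳).hom) = a ≫ 𝒳.hom := by
      rw [← hab, ← h₃a]; simp only [Category.assoc, Over.w (fst 𝒳 𝒳)]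
    have hq₄ : (q₄ ≫ D.ι ≫ (𝒳 ⊗ 𝒳).hom) = a ≫ 𝒳.hom := by
      rw [← h₄a]; simp only [Category.assoc, Over.w (fst 𝒳 𝒳)]
    let aR : TR ⟶ 𝒳 := Over.homMk a rfl
    let bR : TR ⟶ 𝒳 := Over.homMk b hb
    let cR : TR ⟶ 𝒳 := Over.homMk c hc
    let q₁R : TR ⟶ Over.mk (D.ι ≫ (𝒳 ⊗ 𝒳).hom) := Over.homMk q₁ hq₁
    let q₂R : TR ⟶ Over.mk (D.ι ≫ (𝒳 ⊗ 𝒳).hom) := Over.homMk q₂ hq₂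
    let q₃R : TR ⟶ Over.mk (D.ι ≫ (𝒳 ⊗ 𝒳).hom) := Over.homMk q₃ hq₃
    let q₄R : TR ⟶ Over.mk (D.ι ≫ (𝒳 ⊗ 𝒳).hom) := Over.homMk q₄ hq₄
    have hq₁R : q₁R ≫ incl = lift aR bR := by
      ext <;> simp [q₁R, incl, aR, bR, ← h₁a, ← h₁b]
    have hq₂R : q₂R ≫ incl = lift bR cR := by
      ext <;> simp [q₂R, incl, bR, cR, ← h₂a, ← h₂b]
    have hq₃R : q₃R ≫ incl = lift (q₁R ≫ mulR) cR := by
      ext <;> simp [q₃R, q₁R, incl, mulR, cR, h₁m, ← h₃a, ← h₃b]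
    have hq₄R : q₄R ≫ incl = lift aR (q₂R ≫ mulR) := by
      ext <;> simp [q₄R, q₂R, incl, mulR, aR, h₂m, ← h₄a, ← h₄b]
    -- the `T`-point `(a, b, c)` factors through `W₁` …
    let tR : TR ⟶ Y3 := lift (lift aR bR) cR
    have ht12 : tR ≫ p12 = q₁R ≫ incl := by rw [hq₁R]; simp only [tR, p12, lift_fst]
    have ht23 : tR ≫ p23 = q₂R ≫ incl := by
      rw [hq₂R]; ext <;> simp only [tR, p23, comp_lift, lift_fst, lift_snd, lift_fst_assoc]
    have htO₁ : Set.range tR.left.base ⊆ (O₁ : Set Y3.left) := by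
      rintro _ ⟨x, rfl⟩
      refine ⟨?_, ?_⟩
      · change (tR.left ≫ p12.left).base x ∈ (D : Set (𝒳 ⊗ 𝒳).left)
        rw [← Over.comp_left, ht12]
        exact range_comp_openOver_subset' D q₁R ⟨x, rfl⟩
      · change (tR.left ≫ p23.left).base x ∈ (D : Set (𝒳 ⊗ 𝒳).left)
        rw [← Over.comp_left, ht23]
        exact range_comp_openOver_subset' D q₂R ⟨x, rfl⟩
    obtain ⟨t₁, ht₁⟩ := exists_lift_openOver' O₁ tR htO₁
    have ht₁ab : t₁ ≫ qab₁ = q₁R :=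
      cancel_openOver' D (by rw [Category.assoc, hqab₁, ← Category.assoc, ht₁, ht12])
    have ht₁bc : t₁ ≫ qbc₁ = q₂R :=
      cancel_openOver' D (by rw [Category.assoc, hqbc₁, ← Category.assoc, ht₁, ht23])
    -- … and through `W`
    have ht₃ : t₁ ≫ r₃ = q₃R ≫ incl := by
      rw [hq₃R]
      simp only [r₃, comp_lift]
      rw [← Category.assoc t₁ qab₁, ht₁ab, ← Category.assoc t₁ j₁, ht₁]
      simp only [tR, lift_snd]
    have ht₄ : t₁ ≫ r₄ = q₄R ≫ incl := by
      rw [hq₄R]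
      simp only [r₄, comp_lift]
      rw [← Category.assoc t₁ qbc₁, ht₁bc, ← Category.assoc t₁ j₁, ht₁]
      simp only [tR, lift_fst_assoc, lift_fst]
    have htO : Set.range t₁.left.base ⊆ (O : Set W₁.left) := by
      rintro _ ⟨x, rfl⟩
      refine ⟨?_, ?_⟩
      · change (t₁.left ≫ r₃.left).base x ∈ (D : Set (𝒳 ⊗ 𝒳).left)
        rw [← Over.comp_left, ht₃]
        exact range_comp_openOver_subset' D q₃R ⟨x, rfl⟩
      · change (t₁.left ≫ r₄.left).base x ∈ (D : Set (𝒳 ⊗ 𝒳).left)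
        rw [← Over.comp_left, ht₄]
        exact range_comp_openOver_subset' D q₄R ⟨x, rfl⟩
    obtain ⟨t, ht⟩ := exists_lift_openOver' O t₁ htO
    have ht₃' : t ≫ qab_c = q₃R :=
      cancel_openOver' D (by rw [Category.assoc, hqab_c, ← Category.assoc, ht, ht₃])
    have ht₄' : t ≫ qa_bc = q₄R :=
      cancel_openOver' D (by rw [Category.assoc, hqa_bc, ← Category.assoc, ht, ht₄])
    refine ⟨t.left, ?_, ?_, ?_, ?_, ?_, ?_⟩
    · rw [← Over.comp_left, ← Category.assoc, ht₃']; exact h₃m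
    · rw [← Over.comp_left, ← Category.assoc, ht₄']; exact h₄m
    · rw [← Over.comp_left, ← Category.assoc, ht, ← Category.assoc, ht₁, ht12]; rfl
    · rw [← Over.comp_left, ← Category.assoc, ht, ← Category.assoc, ht₁, ht23]; rfl
    · rw [← Over.comp_left, ← Category.assoc, ht, ht₃]; rfl
    · rw [← Over.comp_left, ← Category.assoc, ht, ht₄]; rfl
  -- (2) the open `O₀ ⊆ W` where the four `D₀`-products are defined is non-empty (witness configuration)
  let O₀ : W.left.Opens :=
    ((j ≫ j₁ ≫ p12).left ⁻¹ᵁ D₀ ⊓ (j ≫ j₁ ≫ p23).left ⁻¹ᵁ D₀) ⊓ ((j ≫ r₃).left ⁻¹ᵁ D₀ ⊓ (j ≫ r₄).left ⁻¹ᵁ D₀)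
  haveI hO₀ : Nonempty (O₀ : Scheme.{u}) := by
    obtain ⟨T', ⟨x₀⟩, a', b', c', ab', bc', abc₀, abc₀', q₁', q₂', q₃', q₄', h₁', h₂', h₃', h₄'⟩ := hne
    obtain ⟨t', -, -, ht₁', ht₂', ht₃', ht₄'⟩ :=
      factor (computes_of_le hle h₁') (computes_of_le hle h₂') (computes_of_le hle h₃') (computes_of_le hle h₄')
    refine ⟨⟨t'.base x₀, ⟨?_, ?_⟩, ?_, ?_⟩⟩
    · change (t' ≫ (j ≫ j₁ ≫ p12).left).base x₀ ∈ (D₀ : Set (𝒳 ⊗ 𝒳).left)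
      rw [ht₁', Category.assoc, Scheme.homOfLE_ι, Scheme.Hom.comp_base, TopCat.coe_comp, Function.comp_apply]
      exact (q₁'.base x₀).2
    · change (t' ≫ (j ≫ j₁ ≫ p23).left).base x₀ ∈ (D₀ : Set (𝒳 ⊗ 𝒳).left)
      rw [ht₂', Category.assoc, Scheme.homOfLE_ι, Scheme.Hom.comp_base, TopCat.coe_comp, Function.comp_apply]
      exact (q₂'.base x₀).2
    · change (t' ≫ (j ≫ r₃).left).base x₀ ∈ (D₀ : Set (𝒳 ⊗ 𝒳).left)
      rw [ht₃', Category.assoc, Scheme.homOfLE_ι, Scheme.Hom.comp_base, TopCat.coe_comp, Function.comp_apply]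
      exact (q₃'.base x₀).2
    · change (t' ≫ (j ≫ r₄).left).base x₀ ∈ (D₀ : Set (𝒳 ⊗ 𝒳).left)
      rw [ht₄', Category.assoc, Scheme.homOfLE_ι, Scheme.Hom.comp_base, TopCat.coe_comp, Function.comp_apply]
      exact (q₄'.base x₀).2
  -- (3) UNIVERSAL EQUALITY on `W`: the two triple products agree on the dominant open `O₀`, hence everywhere
  have huniv : qab_c ≫ mulR = qa_bc ≫ mulR := by
    -- the four `D₀`-witnesses on `O₀` …
    have hι12 : Set.range (O₀.ι ≫ (j ≫ j₁ ≫ p12).left).base ⊆ (D₀ : Set (𝒳 ⊗ 𝒳).left) := by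
      rintro _ ⟨x, rfl⟩; exact x.2.1.1
    have hι23 : Set.range (O₀.ι ≫ (j ≫ j₁ ≫ p23).left).base ⊆ (D₀ : Set (𝒳 ⊗ 𝒳).left) := by
      rintro _ ⟨x, rfl⟩; exact x.2.1.2
    have hι₃ : Set.range (O₀.ι ≫ (j ≫ r₃).left).base ⊆ (D₀ : Set (𝒳 ⊗ 𝒳).left) := by
      rintro _ ⟨x, rfl⟩; exact x.2.2.1
    have hι₄ : Set.range (O₀.ι ≫ (j ≫ r₄).left).base ⊆ (D₀ : Set (𝒳 ⊗ 𝒳).left) := by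
      rintro _ ⟨x, rfl⟩; exact x.2.2.2
    obtain ⟨p₁, hp₁⟩ := exists_lift_open' D₀ _ hι12
    obtain ⟨p₂, hp₂⟩ := exists_lift_open' D₀ _ hι23
    obtain ⟨p₃, hp₃⟩ := exists_lift_open' D₀ _ hι₃
    obtain ⟨p₄, hp₄⟩ := exists_lift_open' D₀ _ hι₄
    -- … their lifts to `D` are the `D`-witnesses of `W` …
    have hp₁D : p₁ ≫ (𝒳 ⊗ 𝒳).left.homOfLE hle = O₀.ι ≫ (j ≫ qab₁).left := by
      rw [← cancel_mono D.ι, Category.assoc, Scheme.homOfLE_ι, hp₁, Category.assoc]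
      change _ = O₀.ι ≫ (j ≫ qab₁).left ≫ incl.left
      rw [← Over.comp_left, Category.assoc, hqab₁]
    have hp₂D : p₂ ≫ (𝒳 ⊗ 𝒳).left.homOfLE hle = O₀.ι ≫ (j ≫ qbc₁).left := by
      rw [← cancel_mono D.ι, Category.assoc, Scheme.homOfLE_ι, hp₂, Category.assoc]
      change _ = O₀.ι ≫ (j ≫ qbc₁).left ≫ incl.left
      rw [← Over.comp_left, Category.assoc, hqbc₁]
    have hp₃D : p₃ ≫ (𝒳 ⊗ 𝒳).left.homOfLE hle = O₀.ι ≫ qab_c.left := by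
      rw [← cancel_mono D.ι, Category.assoc, Scheme.homOfLE_ι, hp₃, Category.assoc]
      change _ = O₀.ι ≫ qab_c.left ≫ incl.left
      rw [← Over.comp_left, hqab_c]
    have hp₄D : p₄ ≫ (𝒳 ⊗ 𝒳).left.homOfLE hle = O₀.ι ≫ qa_bc.left := by
      rw [← cancel_mono D.ι, Category.assoc, Scheme.homOfLE_ι, hp₄, Category.assoc]
      change _ = O₀.ι ≫ qa_bc.left ≫ incl.left
      rw [← Over.comp_left, hqa_bc]
    -- … and the coordinates of the `O₀`-valued point
    have e1a : (j ≫ j₁ ≫ p12) ≫ fst 𝒳 𝒳 = j ≫ j₁ ≫ fst _ _ ≫ fst 𝒳 𝒳 := by simp only [Category.assoc, p12]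
    have e1b : (j ≫ j₁ ≫ p12) ≫ snd 𝒳 𝒳 = j ≫ j₁ ≫ fst _ _ ≫ snd 𝒳 𝒳 := by simp only [Category.assoc, p12]
    have e2a : (j ≫ j₁ ≫ p23) ≫ fst 𝒳 𝒳 = j ≫ j₁ ≫ fst _ _ ≫ snd 𝒳 𝒳 := by
      simp only [Category.assoc, p23, lift_fst]
    have e2b : (j ≫ j₁ ≫ p23) ≫ snd 𝒳 𝒳 = j ≫ j₁ ≫ snd _ _ := by simp only [Category.assoc, p23, lift_snd]
    have e3a : (j ≫ r₃) ≫ fst 𝒳 𝒳 = (j ≫ qab₁) ≫ Over.homMk m hm := by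
      simp only [Category.assoc, r₃, mulR, lift_fst]
    have e3b : (j ≫ r₃) ≫ snd 𝒳 𝒳 = j ≫ j₁ ≫ snd _ _ := by simp only [Category.assoc, r₃, lift_snd]
    have e4a : (j ≫ r₄) ≫ fst 𝒳 𝒳 = j ≫ j₁ ≫ fst _ _ ≫ fst 𝒳 𝒳 := by simp only [Category.assoc, r₄, lift_fst]
    have e4b : (j ≫ r₄) ≫ snd 𝒳 𝒳 = (j ≫ qbc₁) ≫ Over.homMk m hm := by
      simp only [Category.assoc, r₄, mulR, lift_snd]
    -- the `D₀`-hypothesis on the `O₀`-valued point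
    have h0 : O₀.ι ≫ qab_c.left ≫ m = O₀.ι ≫ qa_bc.left ≫ m :=
      hassoc₀ (T := O₀) (q₁ := p₁) (q₂ := p₂) (q₃ := p₃) (q₄ := p₄)
        (a := O₀.ι ≫ (j ≫ j₁ ≫ fst _ _ ≫ fst 𝒳 𝒳).left) (b := O₀.ι ≫ (j ≫ j₁ ≫ fst _ _ ≫ snd 𝒳 𝒳).left)
        (c := O₀.ι ≫ (j ≫ j₁ ≫ snd _ _).left)
        (ab := O₀.ι ≫ (j ≫ qab₁).left ≫ m) (bc := O₀.ι ≫ (j ≫ qbc₁).left ≫ m)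
        (abc := O₀.ι ≫ qab_c.left ≫ m) (abc' := O₀.ι ≫ qa_bc.left ≫ m)
        ⟨by rw [← Category.assoc, hp₁, Category.assoc, ← Over.comp_left, e1a],
          by rw [← Category.assoc, hp₁, Category.assoc, ← Over.comp_left, e1b],
          by rw [← Category.assoc, hp₁D, Category.assoc]⟩
        ⟨by rw [← Category.assoc, hp₂, Category.assoc, ← Over.comp_left, e2a],
          by rw [← Category.assoc, hp₂, Category.assoc, ← Over.comp_left, e2b],
          by rw [← Category.assoc, hp₂D, Category.assoc]⟩
        ⟨by rw [← Category.assoc, hp₃, Category.assoc, ← Over.comp_left, e3a, Over.comp_left]; rfl,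
          by rw [← Category.assoc, hp₃, Category.assoc, ← Over.comp_left, e3b],
          by rw [← Category.assoc, hp₃D, Category.assoc]⟩
        ⟨by rw [← Category.assoc, hp₄, Category.assoc, ← Over.comp_left, e4a],
          by rw [← Category.assoc, hp₄, Category.assoc, ← Over.comp_left, e4b, Over.comp_left]; rfl,
          by rw [← Category.assoc, hp₄D, Category.assoc]⟩
    -- dominance, reducedness, separatedness
    haveI : IsDominant O₀.ι := isDominant_ι_of_nonempty (O.ι ≫ O₁.ι : W.left ⟶ Y3.left) O₀
    haveI : IsReduced (O₁ : Scheme.{u}) := inferInstance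
    haveI : IsReduced W₁.left := ‹IsReduced (O₁ : Scheme.{u})›
    haveI : IsReduced (O : Scheme.{u}) := inferInstance
    haveI : IsReduced W.left := ‹IsReduced (O : Scheme.{u})›
    have key : (qab_c ≫ mulR).left = (qa_bc ≫ mulR).left :=
      ext_of_isDominant_of_isSeparated 𝒳.hom (by rw [Over.w, Over.w]) O₀.ι h0
    exact Over.OverMorphism.ext key
  -- (4) conclude
  obtain ⟨t, ht₃, ht₄, -, -, -, -⟩ := factor h₁ h₂ h₃ h₄
  rw [← ht₃, ← ht₄, huniv]

end Literature.AlgebraicGeometry.GroupSchemes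

end
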